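import Mathlib
import Literature.MathematicalPhysics.QuantumFieldTheory.Balaban1983to89.B5Momentum130

/-!
# B5 p. 23: (1.33) — «The second equation gives ω̃(p′) = …» — and the `p′ ≠ 0` part of (1.34),
# for the TYPED position-space operators; and, at B5's lattice constant, the fiber of the
# projection `P` of (1.26)/(1.69)/(1.70) IS pass 5's fiber matrix `Pproj`

Source: T. Bałaban, *Propagators and renormalization transformations for lattice gauge
theories. I*, Commun. Math. Phys. 95 (1984) 17–40 (`Balaban1984PropagatorsI`, "B5"), render
`b2b-balaban-ref1/pages/1984-cmp95-propagators-rt-I/…-p007-x2.png` (journal p. 23; the `-x4` file is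
the coarser downscale), read as an image this session. REVISION v1.1 (docstring-only DOCFIX after the
cross-read GAPS C-pv13g4-2: the two located print slips inside « … » below are now quoted as printed
and flagged `[sic]`; no declaration changed).

## What the paper prints (verbatim, p. 23)

«The first equation in (1.30) can be solved uniquely for p ≠ 0 and we get
λ̃(p) = Δ⁻¹(p)(∂*A)~(p) − Δ⁻²(p)\overline{u_k(p)} ω̃(p′), p ≠ 0, (1.32)
for p = 0 the equation implies ω̃(0) = 0. The second equation gives
ω̃(p′) = (Σ_l |u_k(p′ + l)|²/Δ²(p′ + l))⁻¹ Σ_l (u_k(p′ + l)/Δ(p′ + l)) (∂*A)~(p′ + l) for p′ ≠ 0,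
ω̃(0) = 0. (1.33)
Because u_k(l) = 0 for l ≠ 0, u_k(0) = 1, so this equation implies also λ̃(0) = 0. Thus we get
the solution
λ̃₀(p′ + l) = (1/Δ(p′ + l)) (∂*A)~(p′ + l)
  − (\overline{u_k(p′ + l)}/Δ²(p′ + l)) · (Σ_{l′} |u_k(p′ + l′)|²/Δ²(p′ + l′))⁻¹
      Σ_{l′} (u_k(p′ + l′)/Δ(p′ + l′)) (∂*A)(p′ + l′) [sic: the Fourier tilde on this last
      (∂*A) is missing in print; read (∂*A)~(p′ + l′) as in the first line and in (1.33) — GAPS G-pv13g4-1]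
for p′ ≠ 0, λ̃₀(l) = (1/Δ(l))(∂*A)~(l) for l ≠ 0, λ̃₀(0) = 0. (1.34)»
(The second equation of (1.30) is «Σ_l u_k(p′ + l)λ̃(p′ + l) = 0»; (1.31): «Δ(p) = Σ_{μ=1}^{d}
|∂_μ(p)|², … u_k(p) = Π_{μ=1}^{d} ∂¹_μ(p′)/∂_μ(p)».)

## What is typed and certified here (kernel-checked, zero sorry)

Typed dictionary (passes 3/4/8/11/19/21/22/24, unchanged): `λ̃ = dft (fine n M) *ᵥ λ`,
`ω̃ = dft M *ᵥ ω` (unitary DFTs), `p = p′ + l ↔ pOf n M (k, q)` (`q ↔ p′`, `k ↔ l`),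
`Δ(p) = lsym (fine n M) c p`, `u_k(p′ + l) = uSym n k (sOf M q)`, `Δ = LapS (fine n M) c`,
`Δ⁻¹ = LapSinv (fine n M) c` («putting its value on constant functions equal to 0»),
`Q′_k = QsOp n M`, `Q′_kΔ⁻²Q′*_k = Mop n M c`, the typed solution `ω₀ = omega0 n M c b`,
`λ₀ = lambda0 n M c b` of pass 22 (`∂*A = b`), `P = PcT n M c` (pass 22); the momentum
representations of `Q′_k`, `Q′*_k` carry the constant `cQ = (√(n^d))⁻¹` (`B5Block118.dft_QsOp`,
`B5Adjoint130.dft_QsOp_adjoint`), so the role of the printed `ω̃(p′)` is played by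
`cQ · (dft M *ᵥ ω) p′`, exactly as in pass 24's `lhs130`/`eq132`.  The two printed sums of (1.33):
`Xs n M c q = Σ_l |u_k(p′+l)|²/Δ²(p′+l)` and `Bs n M c b q = Σ_l (u_k(p′+l)/Δ(p′+l))(∂*A)~(p′+l)`.
* §1 (any torus): `dft_mul_LapSinv`, `linv_eq_inv`, `dft_LapSinv_apply` — `(Δ⁻¹f)~(p) =
  Δ(p)⁻¹f̃(p)` (`= 0` at `p = 0`), `lsym_eq_sum_norm_sq` (`Δ(p) = Σ_ν |∂_ν(p)|²` as a real number);
* §2: `dft_Mop_apply` — `(Q′_kΔ⁻²Q′*_kω)~(p′) = cQ² · Xs(p′) · ω̃(p′)` —, `dft_QsOp_LapSinv_apply` —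
  `(Q′_kΔ⁻¹∂*A)~(p′) = cQ · Bs(p′)` — (the momentum representation of the two sides of pass 21's
  «Q′_kΔ⁻²Q′*_kω = Q′_kΔ⁻¹∂*A», i.e. of the second equation of (1.30) after the substitution
  (1.32));
* §3: `lsym_pOf_ne_zero`, `Xs_eq`, `Xs_re_pos`, `Xs_ne_zero` — for `p′ ≠ 0` the printed
  normalising sum `Σ_l |u_k(p′+l)|²/Δ²(p′+l)` is `> 0` (its `l = 0` term: `|u_k(p′)|² ≥ (4/π²)^d`,
  `B4Strip.Ur_zero_ge`, and `Δ(p′) ≠ 0` by pass 24's `lsym_eq_zero_iff`), so (1.33) makes sense;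
* §4: `eq133` — (1.33) for `p′ ≠ 0` for EVERY solution `(λ, ω)` of (1.25) with `λ ⊥ 1`
  (`∂*A = b ⊥ 1`, `c ≠ 0`) —, `omega0_hat` — (1.33) for the typed `ω₀` (every `b`) —,
  `omega0_hat_zero` — «ω̃(0) = 0» for `ω₀`;
* §5: `eq134` — the `p′ ≠ 0` part of (1.34) for every such solution —, `lambda0_hat_def`,
  `lambda0_hat` — the `p′ ≠ 0` part of (1.34) for the typed `λ₀` (the `p′ = 0` part is pass 24's
  `lambda0_hat_l`, `lambda0_hat_zero`);
* §6 (B5's lattice constant `c = n`, i.e. `η = n⁻¹` on the unit coarse lattice, as in passes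
  3/4/13/14): `ssym_pOf`, `lsym_pOf`, `lsym_pOf_fiber` — `Δ(p′+l)` of Sect. C IS the `Δ` of the
  pass-5 fiber `fiberAt q` (`B5FiberDelta.fiberAt_Δ`) —, `Xs_eq_fiberX` — `Xs(p′) = X(p′)` of
  `B5Prop11Bound.Fiber` —, `omega0_hat_fiber`, `dft_PcT_apply`, `dft_PcT_apply_of_ne`,
  `dft_PcT_zero_fiber` — `(P b)~` vanishes on the whole fiber `p′ = 0` —, `fiber_PcT` — THE
  IDENTIFICATION: for `p′ ≠ 0`, `(P b)~(p′+l) = Σ_{l′} Pproj(fiberAt p′)_{l l′} b̃(p′+l′)` with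
  pass 5's `B5Prop11Inverse.Pproj = Δ⁻¹Q′*(Q′Δ⁻²Q′*)⁻¹Q′Δ⁻¹` of the fiber algebra (1.73) —, and
  `fiber_lambda0` — `λ̃₀(p′+l) = Σ_{l′} (Δ⁻¹(I − Pproj))_{l l′} b̃(p′+l′)`, the blocks of
  `λ₀ = Δ⁻¹(I − P)∂*A` are pass 5's `lapSinv · (1 − Pproj)` («R = I − P», (1.69)).
With `B5FiberDelta.dft_Lap_fiber` (term `Δ`) and `B5FiberQQ.fiber_QstarQ` (term `aQ*Q`) this
supplies the scalar projection `P` entering the third term `∂P∂*` of `Δ_a = Δ − ∂P∂* + aQ*Q`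
((1.69)) fiberwise; the conjugation by `∂`, `∂*` (vector ↔ scalar fields) is not composed here.

## What is NOT certified here

The Gaussian-integral identities (1.24)/(1.27)/(1.28) as integrals; the operator identity
`calDa = Δ − ∂P∂* + aQ*Q` of pass 5 with the position-space operators as a whole (only its three
scalar/fiber ingredients are now matched); B5's `η^d`-normalised transform (we use unitary DFTs,
whence the explicit constant `cQ`); fields complex.
-/

open scoped BigOperators Matrix ComplexConjugate ComplexOrder
open Finset Complex Matrix

namespace Literature.MathematicalPhysics.QuantumFieldTheory.Balaban1983to89.B5Momentum133

open Literature.MathematicalPhysics.QuantumFieldTheory.Balaban1983to89.B4Strip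
open Literature.MathematicalPhysics.QuantumFieldTheory.Balaban1983to89.B5Prop11Fiber
open Literature.MathematicalPhysics.QuantumFieldTheory.Balaban1983to89.B5Prop11Plancherel
open Literature.MathematicalPhysics.QuantumFieldTheory.Balaban1983to89.B5Action121
open Literature.MathematicalPhysics.QuantumFieldTheory.Balaban1983to89.B5Block118
open Literature.MathematicalPhysics.QuantumFieldTheory.Balaban1983to89.B5Constraint130
open Literature.MathematicalPhysics.QuantumFieldTheory.Balaban1983to89.B5Adjoint130
open Literature.MathematicalPhysics.QuantumFieldTheory.Balaban1983to89.B5FiberQQ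
open Literature.MathematicalPhysics.QuantumFieldTheory.Balaban1983to89.B5FiberDelta
open Literature.MathematicalPhysics.QuantumFieldTheory.Balaban1983to89.B5FiberZero
open Literature.MathematicalPhysics.QuantumFieldTheory.Balaban1983to89.B5LaplaceSpectral
open Literature.MathematicalPhysics.QuantumFieldTheory.Balaban1983to89.B5LaplaceInverse
open Literature.MathematicalPhysics.QuantumFieldTheory.Balaban1983to89.B5Substitution125
open Literature.MathematicalPhysics.QuantumFieldTheory.Balaban1983to89.B5Value126
open Literature.MathematicalPhysics.QuantumFieldTheory.Balaban1983to89.B5Momentum130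

noncomputable section

/-! ## §1 `(Δ⁻¹f)~(p) = Δ(p)⁻¹f̃(p)` -/

section Torus

variable {d : ℕ} (N : Fin d → ℕ) [hN : ∀ ν, NeZero (N ν)]

/-- `UΔ⁻¹ = diag(linv)U` (`Δ⁻¹` is the Fourier multiplier `linv`). [folklore] -/
theorem dft_mul_LapSinv (c : ℂ) : dft N * LapSinv N c = Matrix.diagonal (linv N c) * dft N := by
  rw [LapSinv, ← Matrix.mul_assoc, ← Matrix.mul_assoc, dft_mul_conjTranspose, Matrix.one_mul]

/-- `linv(p) = Δ(p)⁻¹` (with `0⁻¹ = 0` at `p = 0`: «putting its value on constant functions equal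
to 0»). [folklore] -/
theorem linv_eq_inv (c : ℂ) (p : Tor N) : linv N c p = (lsym N c p)⁻¹ := by
  unfold linv
  split_ifs with h
  · rw [h, _root_.inv_zero]
  · rw [one_div]

/-- `(Δ⁻¹f)~(p) = Δ(p)⁻¹·f̃(p)`. [cite: Balaban1984PropagatorsI, Sect. C p.22, (1.32) p.23] -/
theorem dft_LapSinv_apply (c : ℂ) (f : Tor N → ℂ) (p : Tor N) :
    (dft N *ᵥ (LapSinv N c *ᵥ f)) p = (lsym N c p)⁻¹ * (dft N *ᵥ f) p := by
  rw [Matrix.mulVec_mulVec, dft_mul_LapSinv, ← Matrix.mulVec_mulVec, Matrix.mulVec_diagonal,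
    linv_eq_inv]

/-- `Δ(p) = Σ_ν |∂_ν(p)|²` as (the cast of) a real number. [cite: Balaban1984PropagatorsI, (1.31) p.23] -/
theorem lsym_eq_sum_norm_sq (c : ℂ) (p : Tor N) :
    lsym N c p = ((∑ ν, ‖ssym N c ν p‖ ^ 2 : ℝ) : ℂ) := by
  simp only [lsym]
  push_cast
  refine Finset.sum_congr rfl fun ν _ => ?_
  rw [← Complex.ofReal_pow, Complex.sq_norm, Complex.normSq_eq_conj_mul_self]

end Torus

variable {d : ℕ} (n : ℕ) [NeZero n] (M : Fin d → ℕ) [hM : ∀ μ, NeZero (M μ)] (c : ℂ)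

/-! ## §2 The two printed sums of (1.33) and the momentum form of `Q′_kΔ⁻²Q′*_k`, `Q′_kΔ⁻¹` -/

/-- the printed normalising sum of (1.33): `Σ_l |u_k(p′ + l)|²/Δ²(p′ + l)` at `p′ ↔ q`.
[cite: Balaban1984PropagatorsI, (1.33) p.23] -/
def Xs (q : Tor M) : ℂ :=
  ∑ k : Fin d → Fin n,
    ((‖uSym n k (sOf M q)‖ ^ 2 : ℝ) : ℂ) / lsym (fine n M) c (pOf n M (k, q)) ^ 2

/-- the printed sum `Σ_l (u_k(p′ + l)/Δ(p′ + l)) (∂*A)~(p′ + l)` of (1.33) at `p′ ↔ q` (`∂*A = b`).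
[cite: Balaban1984PropagatorsI, (1.33) p.23] -/
def Bs (b : Tor (fine n M) → ℂ) (q : Tor M) : ℂ :=
  ∑ k : Fin d → Fin n,
    uSym n k (sOf M q) / lsym (fine n M) c (pOf n M (k, q)) * (dft (fine n M) *ᵥ b) (pOf n M (k, q))

/-- `(Q′_kΔ⁻²Q′*_kω)~(p′) = cQ² · (Σ_l |u_k(p′+l)|²/Δ²(p′+l)) · ω̃(p′)`: the left side of the
second equation of (1.30) after the substitution (1.32), `ω`-part.
[cite: Balaban1984PropagatorsI, (1.30)–(1.33) p.23] -/
theorem dft_Mop_apply (ω : Tor M → ℂ) (q : Tor M) :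
    (dft M *ᵥ (Mop n M c *ᵥ ω)) q = (cQ n M : ℂ) ^ 2 * Xs n M c q * (dft M *ᵥ ω) q := by
  rw [Mop_mulVec, dft_QsOp]
  simp_rw [dft_LapSinv_apply, dft_QsOp_adjoint]
  rw [Xs, Finset.mul_sum, Finset.mul_sum, Finset.sum_mul]
  refine Finset.sum_congr rfl fun k _ => ?_
  rw [Complex.ofReal_pow, ← Complex.mul_conj']
  ring

/-- `(Q′_kΔ⁻¹∂*A)~(p′) = cQ · Σ_l (u_k(p′+l)/Δ(p′+l))(∂*A)~(p′+l)`: the `∂*A`-part.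
[cite: Balaban1984PropagatorsI, (1.30)–(1.33) p.23] -/
theorem dft_QsOp_LapSinv_apply (b : Tor (fine n M) → ℂ) (q : Tor M) :
    (dft M *ᵥ (QsOp n M *ᵥ (LapSinv (fine n M) c *ᵥ b))) q = (cQ n M : ℂ) * Bs n M c b q := by
  rw [dft_QsOp, Bs]
  congr 1
  refine Finset.sum_congr rfl fun k _ => ?_
  rw [dft_LapSinv_apply, div_eq_mul_inv]
  ring

/-! ## §3 `Σ_l |u_k(p′+l)|²/Δ²(p′+l) > 0` for `p′ ≠ 0` -/

/-- `Δ(p′ + l) ≠ 0` for `p′ ≠ 0` (every `l`; `c ≠ 0`). [folklore] -/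
theorem lsym_pOf_ne_zero (hc : c ≠ 0) (k : Fin d → Fin n) {q : Tor M} (hq : q ≠ 0) :
    lsym (fine n M) c (pOf n M (k, q)) ≠ 0 := by
  intro h0
  have h1 := (lsym_eq_zero_iff (fine n M) hc _).mp h0
  have h2 := pOf_injective n M (h1.trans (pOf_zero n M).symm)
  exact hq (congrArg Prod.snd h2)

/-- the normalising sum as (the cast of) a real number. [folklore] -/
theorem Xs_eq (q : Tor M) :
    Xs n M c q
      = ((∑ k : Fin d → Fin n, ‖uSym n k (sOf M q)‖ ^ 2
            / (∑ ν, ‖ssym (fine n M) c ν (pOf n M (k, q))‖ ^ 2) ^ 2 : ℝ) : ℂ) := by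
  rw [Xs]
  push_cast
  refine Finset.sum_congr rfl fun k _ => ?_
  rw [lsym_eq_sum_norm_sq]
  push_cast
  rfl

/-- `Σ_l |u_k(p′+l)|²/Δ²(p′+l) > 0` for `p′ ≠ 0`: the `l = 0` term is `|u_k(p′)|²/Δ²(p′)` with
`|u_k(p′)|² ≥ (4/π²)^d` (tree lemma `B4Strip.Ur_zero_ge`) and `Δ(p′) ≠ 0` (`c ≠ 0`).
[cite: Balaban1984PropagatorsI, (1.33) p.23 (positivity proof ours)] -/
theorem Xs_re_pos (hc : c ≠ 0) {q : Tor M} (hq : q ≠ 0) :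
    0 < ∑ k : Fin d → Fin n, ‖uSym n k (sOf M q)‖ ^ 2
          / (∑ ν, ‖ssym (fine n M) c ν (pOf n M (k, q))‖ ^ 2) ^ 2 := by
  have hn : 1 ≤ n := Nat.one_le_iff_ne_zero.mpr (NeZero.ne n)
  have hs : ∀ μ, |sOf M q μ| ≤ Real.pi := abs_sOf_le M q
  have hu : 0 < ‖uSym n (fun _ => (0 : Fin n)) (sOf M q)‖ ^ 2 := by
    rw [norm_uSym_sq n hn _ _ hs]
    exact lt_of_lt_of_le (by positivity) (Ur_zero_ge n hn (sOf M q) hs)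
  have hl : (∑ ν, ‖ssym (fine n M) c ν (pOf n M ((fun _ => (0 : Fin n)), q))‖ ^ 2) ≠ 0 := by
    intro h0
    apply lsym_pOf_ne_zero n M c hc (fun _ => (0 : Fin n)) hq
    rw [lsym_eq_sum_norm_sq, h0, Complex.ofReal_zero]
  have hden : 0 < (∑ ν, ‖ssym (fine n M) c ν (pOf n M ((fun _ => (0 : Fin n)), q))‖ ^ 2) ^ 2 :=
    pow_pos (lt_of_le_of_ne (Finset.sum_nonneg fun ν _ => sq_nonneg _) (Ne.symm hl)) 2
  exact lt_of_lt_of_le (div_pos hu hden)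
    (Finset.single_le_sum
      (f := fun k : Fin d → Fin n => ‖uSym n k (sOf M q)‖ ^ 2
          / (∑ ν, ‖ssym (fine n M) c ν (pOf n M (k, q))‖ ^ 2) ^ 2)
      (fun k _ => div_nonneg (sq_nonneg _) (sq_nonneg _)) (Finset.mem_univ _))

/-- `Σ_l |u_k(p′+l)|²/Δ²(p′+l) ≠ 0` for `p′ ≠ 0` (`c ≠ 0`), so its inverse in (1.33) is a genuine
inverse. [cite: Balaban1984PropagatorsI, (1.33) p.23] -/
theorem Xs_ne_zero (hc : c ≠ 0) {q : Tor M} (hq : q ≠ 0) : Xs n M c q ≠ 0 := by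
  rw [Xs_eq]
  exact_mod_cast (Xs_re_pos n M c hc hq).ne'

/-! ## §4 (1.33) -/

/-- (1.33), `p′ ≠ 0`: «The second equation gives ω̃(p′) = (Σ_l |u_k(p′+l)|²/Δ²(p′+l))⁻¹
Σ_l (u_k(p′+l)/Δ(p′+l))(∂*A)~(p′+l) for p′ ≠ 0» — for EVERY solution `(λ, ω)` of (1.25) with
`λ ⊥ 1` (`∂*A = b ⊥ 1`, `c ≠ 0`; typed `ω̃ ↦ cQ·ω̃`). [cite: Balaban1984PropagatorsI, (1.33) p.23] -/
theorem eq133 (hc : c ≠ 0) (lam b : Tor (fine n M) → ℂ) (ω : Tor M → ℂ)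
    (hlam : ∑ x, lam x = 0) (hb : ∑ x, b x = 0)
    (h125 : LapS (fine n M) c *ᵥ (LapS (fine n M) c *ᵥ lam) - LapS (fine n M) c *ᵥ b
      + (QsOp n M)ᴴ *ᵥ ω = 0)
    (h2nd : QsOp n M *ᵥ lam = 0) {q : Tor M} (hq : q ≠ 0) :
    (cQ n M : ℂ) * (dft M *ᵥ ω) q = (Xs n M c q)⁻¹ * Bs n M c b q := by
  have h := congrArg (fun v : Tor M → ℂ => (dft M *ᵥ v) q)
    (substituted n M c hc lam b ω hlam hb h125 h2nd)
  rw [dft_Mop_apply, dft_QsOp_LapSinv_apply] at h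
  rw [eq_inv_mul_iff_mul_eq₀ (Xs_ne_zero n M c hc hq)]
  apply mul_left_cancel₀ (cQ_ne_zero n M)
  linear_combination h

/-- (1.33) for the typed `ω₀ = (Q′_kΔ⁻²Q′*_k)⁻¹Q′_kΔ⁻¹∂*A` of Sect. C, `p′ ≠ 0` (every `b`, `c ≠ 0`).
[cite: Balaban1984PropagatorsI, (1.33) p.23] -/
theorem omega0_hat (hc : c ≠ 0) (b : Tor (fine n M) → ℂ) {q : Tor M} (hq : q ≠ 0) :
    (cQ n M : ℂ) * (dft M *ᵥ omega0 n M c b) q = (Xs n M c q)⁻¹ * Bs n M c b q := by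
  have h := congrArg (fun v : Tor M → ℂ => (dft M *ᵥ v) q)
    (Mop_Minv_of_orth n M c hc _ (sum_QsOp_LapSinv n M c b))
  rw [dft_Mop_apply, dft_QsOp_LapSinv_apply] at h
  rw [omega0, eq_inv_mul_iff_mul_eq₀ (Xs_ne_zero n M c hc hq)]
  apply mul_left_cancel₀ (cQ_ne_zero n M)
  linear_combination h

/-- (1.33), `p′ = 0`: «ω̃(0) = 0» for the typed `ω₀` (`ω₀ ⊥ 1`; `c ≠ 0`).
[cite: Balaban1984PropagatorsI, (1.33) p.23] -/
theorem omega0_hat_zero (hc : c ≠ 0) (b : Tor (fine n M) → ℂ) :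
    (dft M *ᵥ omega0 n M c b) 0 = 0 := by
  rw [dft_zero_apply, omega0, sum_Minv_of_orth n M c hc _ (sum_QsOp_LapSinv n M c b), mul_zero]

/-! ## §5 The `p′ ≠ 0` part of (1.34) -/

/-- (1.34), `p′ ≠ 0`, for every solution `(λ, ω)` of (1.25) with `λ ⊥ 1` (`∂*A = b ⊥ 1`, `c ≠ 0`):
`λ̃(p′+l) = (1/Δ(p′+l))(∂*A)~(p′+l) − (\overline{u_k(p′+l)}/Δ²(p′+l))·(Σ_{l′}|u_k(p′+l′)|²/Δ²(p′+l′))⁻¹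
Σ_{l′}(u_k(p′+l′)/Δ(p′+l′))(∂*A)~(p′+l′)`. [cite: Balaban1984PropagatorsI, (1.34) p.23] -/
theorem eq134 (hc : c ≠ 0) (lam b : Tor (fine n M) → ℂ) (ω : Tor M → ℂ)
    (hlam : ∑ x, lam x = 0) (hb : ∑ x, b x = 0)
    (h125 : LapS (fine n M) c *ᵥ (LapS (fine n M) c *ᵥ lam) - LapS (fine n M) c *ᵥ b
      + (QsOp n M)ᴴ *ᵥ ω = 0)
    (h2nd : QsOp n M *ᵥ lam = 0) (k : Fin d → Fin n) {q : Tor M} (hq : q ≠ 0) :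
    (dft (fine n M) *ᵥ lam) (pOf n M (k, q))
      = 1 / lsym (fine n M) c (pOf n M (k, q)) * (dft (fine n M) *ᵥ b) (pOf n M (k, q))
        - conj (uSym n k (sOf M q)) / lsym (fine n M) c (pOf n M (k, q)) ^ 2
          * ((Xs n M c q)⁻¹ * Bs n M c b q) := by
  have hp : pOf n M (k, q) ≠ 0 := fun h0 =>
    hq (congrArg Prod.snd (pOf_injective n M (h0.trans (pOf_zero n M).symm)))
  rw [eq132 n M c hc lam b ω h125 k q hp, ← eq133 n M c hc lam b ω hlam hb h125 h2nd hq]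
  ring

/-- `λ̃₀` at every momentum, straight from the definition `λ₀ = Δ⁻¹∂*A − Δ⁻²Q′*_kω₀`:
`λ̃₀(p′+l) = Δ(p′+l)⁻¹(∂*A)~(p′+l) − Δ(p′+l)⁻²·cQ·\overline{u_k(p′+l)}·ω̃₀(p′)` (every `b`, `c`, `p`).
[cite: Balaban1984PropagatorsI, Sect. C p.22, (1.32) p.23] -/
theorem lambda0_hat_def (b : Tor (fine n M) → ℂ) (k : Fin d → Fin n) (q : Tor M) :
    (dft (fine n M) *ᵥ lambda0 n M c b) (pOf n M (k, q))
      = (lsym (fine n M) c (pOf n M (k, q)))⁻¹ * (dft (fine n M) *ᵥ b) (pOf n M (k, q))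
        - (lsym (fine n M) c (pOf n M (k, q)))⁻¹ ^ 2
          * ((cQ n M : ℂ) * conj (uSym n k (sOf M q)) * (dft M *ᵥ omega0 n M c b) q) := by
  rw [lambda0, Matrix.mulVec_sub, Pi.sub_apply, dft_LapSinv_apply, dft_LapSinv_apply,
    dft_LapSinv_apply, dft_QsOp_adjoint]
  ring

/-- (1.34), `p′ ≠ 0`, for the typed `λ₀` of Sect. C (every `b`; `c ≠ 0`):
`λ̃₀(p′+l) = (1/Δ(p′+l))(∂*A)~(p′+l) − (\overline{u_k(p′+l)}/Δ²(p′+l))·(Σ_{l′}|u_k(p′+l′)|²/Δ²(p′+l′))⁻¹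
Σ_{l′}(u_k(p′+l′)/Δ(p′+l′))(∂*A)~(p′+l′)` (the `p′ = 0` part: `B5Momentum130.lambda0_hat_l`,
`lambda0_hat_zero`). [cite: Balaban1984PropagatorsI, (1.34) p.23] -/
theorem lambda0_hat (hc : c ≠ 0) (b : Tor (fine n M) → ℂ) (k : Fin d → Fin n) {q : Tor M}
    (hq : q ≠ 0) :
    (dft (fine n M) *ᵥ lambda0 n M c b) (pOf n M (k, q))
      = 1 / lsym (fine n M) c (pOf n M (k, q)) * (dft (fine n M) *ᵥ b) (pOf n M (k, q))
        - conj (uSym n k (sOf M q)) / lsym (fine n M) c (pOf n M (k, q)) ^ 2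
          * ((Xs n M c q)⁻¹ * Bs n M c b q) := by
  rw [lambda0_hat_def, ← omega0_hat n M c hc b hq]
  ring

/-! ## §6 At B5's lattice constant `c = n`: the fiber of `P` is pass 5's `Pproj` -/

/-- on the coset `p = p′ + l`: `∂_ν(p′ + l)` of the scalar difference is `dSym n k (sOf q) ν`
(pass 4's `fsym_emb`). [cite: Balaban1984PropagatorsI, (1.31) p.23] -/
theorem ssym_pOf (k : Fin d → Fin n) (q : Tor M) (ν : Fin d) :
    ssym (fine n M) (n : ℂ) ν (pOf n M (k, q)) = dSym n k (sOf M q) ν := by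
  have h := fsym_emb n M k ν q ν
  rw [emb_eq] at h
  exact h

/-- `Δ(p′ + l) = DeltaXir n 0 (shiftr n l (sOf p′))` (`B5Prop11Fiber.Delta_eq`).
[cite: Balaban1984PropagatorsI, (1.31) p.23] -/
theorem lsym_pOf (k : Fin d → Fin n) (q : Tor M) :
    lsym (fine n M) (n : ℂ) (pOf n M (k, q)) = ((DeltaXir n 0 (shiftr n k (sOf M q)) : ℝ) : ℂ) := by
  rw [Delta_eq, lsym_eq_sum_norm_sq]
  simp_rw [ssym_pOf]

/-- `Δ(p′ + l)` of Sect. C is the `Δ` of the pass-5 fiber at `p′ ↔ q ≠ 0` (`B5FiberDelta.fiberAt_Δ`).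
[cite: Balaban1984PropagatorsI, (1.31) p.23, (1.83) p.31] -/
theorem lsym_pOf_fiber (hn : 1 ≤ n) (a : ℝ) (ha : 0 < a) {q : Tor M} (hq : q ≠ 0)
    (k : Fin d → Fin n) :
    lsym (fine n M) (n : ℂ) (pOf n M (k, q)) = (((fiberAt n M hn a ha q hq).Δ k : ℝ) : ℂ) := by
  rw [lsym_pOf, fiberAt_Δ]

/-- `Σ_l |u_k(p′+l)|²/Δ²(p′+l)` of (1.33) is the `X(p′)` of the pass-5 fiber (`B5Prop11Bound.Fiber.X`).
[cite: Balaban1984PropagatorsI, (1.33) p.23, (1.83) p.31] -/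
theorem Xs_eq_fiberX (hn : 1 ≤ n) (a : ℝ) (ha : 0 < a) {q : Tor M} (hq : q ≠ 0) :
    Xs n M (n : ℂ) q = ((fiberAt n M hn a ha q hq).X : ℂ) := by
  rw [Xs, B5Prop11Bound.Fiber.X]
  push_cast
  refine Finset.sum_congr rfl fun k _ => ?_
  rw [lsym_pOf_fiber n M hn a ha hq k, fiberAt_u]

/-- (1.33) for `ω₀` in the fiber's language: `cQ·ω̃₀(p′) = X(p′)⁻¹ Σ_l (u(l)/Δ(l)) b̃(p′+l)`.
[cite: Balaban1984PropagatorsI, (1.33) p.23] -/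
theorem omega0_hat_fiber (hn : 1 ≤ n) (a : ℝ) (ha : 0 < a) (b : Tor (fine n M) → ℂ) {q : Tor M}
    (hq : q ≠ 0) :
    (cQ n M : ℂ) * (dft M *ᵥ omega0 n M (n : ℂ) b) q
      = ((fiberAt n M hn a ha q hq).X : ℂ)⁻¹
          * ∑ k : Fin d → Fin n, (fiberAt n M hn a ha q hq).u k
              / (((fiberAt n M hn a ha q hq).Δ k : ℝ) : ℂ) * (dft (fine n M) *ᵥ b) (pOf n M (k, q)) := by
  have hnc : (n : ℂ) ≠ 0 := by exact_mod_cast NeZero.ne n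
  rw [omega0_hat n M (n : ℂ) hnc b hq, Xs_eq_fiberX n M hn a ha hq, Bs]
  congr 1
  refine Finset.sum_congr rfl fun k _ => ?_
  rw [fiberAt_u, lsym_pOf_fiber n M hn a ha hq k]

/-- the momentum form of `P = Δ⁻¹Q′*_k(Q′_kΔ⁻²Q′*_k)⁻¹Q′_kΔ⁻¹` (every `c`, `b`, `p`):
`(P b)~(p′+l) = Δ(p′+l)⁻¹ · cQ · \overline{u_k(p′+l)} · ω̃₀(p′)`.
[cite: Balaban1984PropagatorsI, (1.26) p.22, (1.70) p.30] -/
theorem dft_PcT_apply (b : Tor (fine n M) → ℂ) (k : Fin d → Fin n) (q : Tor M) :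
    (dft (fine n M) *ᵥ (PcT n M c *ᵥ b)) (pOf n M (k, q))
      = (lsym (fine n M) c (pOf n M (k, q)))⁻¹
          * ((cQ n M : ℂ) * conj (uSym n k (sOf M q)) * (dft M *ᵥ omega0 n M c b) q) := by
  rw [PcT_mulVec, dft_LapSinv_apply, dft_QsOp_adjoint, omega0]

/-- `p′ ≠ 0`: `(P b)~(p′+l) = (\overline{u_k(p′+l)}/Δ(p′+l)) · (Σ_{l′}|u_k|²/Δ²)⁻¹ Σ_{l′}(u_k/Δ) b̃`
(`c ≠ 0`). [cite: Balaban1984PropagatorsI, (1.33)–(1.34) p.23, (1.70) p.30] -/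
theorem dft_PcT_apply_of_ne (hc : c ≠ 0) (b : Tor (fine n M) → ℂ) (k : Fin d → Fin n) {q : Tor M}
    (hq : q ≠ 0) :
    (dft (fine n M) *ᵥ (PcT n M c *ᵥ b)) (pOf n M (k, q))
      = conj (uSym n k (sOf M q)) / lsym (fine n M) c (pOf n M (k, q))
          * ((Xs n M c q)⁻¹ * Bs n M c b q) := by
  rw [dft_PcT_apply, ← omega0_hat n M c hc b hq]
  ring

/-- `p′ = 0`: `(P b)~(l) = 0` for EVERY `l` («u_k(l) = 0 for l ≠ 0», and `Δ⁻¹` vanishes on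
constants at `l = 0`) — `P` has no `p′ = 0` component (every `c`, `b`).
[cite: Balaban1984PropagatorsI, (1.33)–(1.34) p.23] -/
theorem dft_PcT_zero_fiber (b : Tor (fine n M) → ℂ) (k : Fin d → Fin n) :
    (dft (fine n M) *ᵥ (PcT n M c *ᵥ b)) (pOf n M (k, 0)) = 0 := by
  rw [dft_PcT_apply, uSym_sOf_zero]
  by_cases hk : k = 0
  · subst hk
    rw [pOf_zero, lsym_zero, _root_.inv_zero, zero_mul]
  · rw [if_neg hk, map_zero, mul_zero, zero_mul, mul_zero]

/-- THE IDENTIFICATION (`c = n`, `p′ ≠ 0`): `(P b)~(p′+l) = Σ_{l′} Pproj(F)_{l l′} b̃(p′+l′)` with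
`F = fiberAt p′` and pass 5's `Pproj F = Δ⁻¹Q′*(Q′Δ⁻²Q′*)⁻¹Q′Δ⁻¹` of the fiber algebra (1.73) —
the position-space `P` of (1.26)/(1.69)/(1.70) IS, fiberwise, the `P` of `B5Prop11Inverse`.
[cite: Balaban1984PropagatorsI, (1.70) p.30, (1.73) p.30, (1.33) p.23] -/
theorem fiber_PcT (hn : 1 ≤ n) (a : ℝ) (ha : 0 < a) (b : Tor (fine n M) → ℂ)
    (k : Fin d → Fin n) {q : Tor M} (hq : q ≠ 0) :
    (dft (fine n M) *ᵥ (PcT n M (n : ℂ) *ᵥ b)) (pOf n M (k, q))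
      = ∑ k' : Fin d → Fin n, B5Prop11Inverse.Pproj (fiberAt n M hn a ha q hq) k k'
          * (dft (fine n M) *ᵥ b) (pOf n M (k', q)) := by
  have hnc : (n : ℂ) ≠ 0 := by exact_mod_cast NeZero.ne n
  rw [dft_PcT_apply_of_ne n M (n : ℂ) hnc b k hq, Xs_eq_fiberX n M hn a ha hq, Bs,
    Finset.mul_sum, Finset.mul_sum]
  refine Finset.sum_congr rfl fun k' _ => ?_
  rw [B5Prop11Inverse.Pproj_apply, fiberAt_u, fiberAt_u, ← lsym_pOf_fiber n M hn a ha hq k,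
    ← lsym_pOf_fiber n M hn a ha hq k']
  have hl := lsym_pOf_ne_zero n M (n : ℂ) hnc k hq
  have hl' := lsym_pOf_ne_zero n M (n : ℂ) hnc k' hq
  have hX : ((fiberAt n M hn a ha q hq).X : ℂ) ≠ 0 := by
    exact_mod_cast (fiberAt n M hn a ha q hq).X_pos.ne'
  field_simp

/-- (1.34) in the fiber's language (`c = n`, `p′ ≠ 0`): `λ̃₀(p′+l) = Σ_{l′} (Δ⁻¹(I − Pproj(F)))_{l l′}
b̃(p′+l′)` — the blocks of `λ₀ = Δ⁻¹(I − P)∂*A = Δ⁻¹R∂*A` are pass 5's `lapSinv F · (1 − Pproj F)`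
(«R = I − Δ⁻¹Q′*_kQ′_kΔ⁻²Q′*_k)⁻¹Q′_kΔ⁻¹» [sic: the opening parenthesis is missing in print; read
`R = I − Δ⁻¹Q′*_k(Q′_kΔ⁻²Q′*_k)⁻¹Q′_kΔ⁻¹` — GAPS G-B5-14 (i)] (1.38); «R = I − P» (1.69)).
[cite: Balaban1984PropagatorsI, (1.34) p.23, (1.38) p.24, (1.69) p.29] -/
theorem fiber_lambda0 (hn : 1 ≤ n) (a : ℝ) (ha : 0 < a) (b : Tor (fine n M) → ℂ)
    (k : Fin d → Fin n) {q : Tor M} (hq : q ≠ 0) :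
    (dft (fine n M) *ᵥ lambda0 n M (n : ℂ) b) (pOf n M (k, q))
      = ∑ k' : Fin d → Fin n,
          (B5Prop11Inverse.lapSinv (fiberAt n M hn a ha q hq)
              * (1 - B5Prop11Inverse.Pproj (fiberAt n M hn a ha q hq))) k k'
            * (dft (fine n M) *ᵥ b) (pOf n M (k', q)) := by
  have hR : (∑ k' : Fin d → Fin n,
        (B5Prop11Inverse.lapSinv (fiberAt n M hn a ha q hq)
            * (1 - B5Prop11Inverse.Pproj (fiberAt n M hn a ha q hq))) k k'
          * (dft (fine n M) *ᵥ b) (pOf n M (k', q)))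
      = ((B5Prop11Inverse.lapSinv (fiberAt n M hn a ha q hq)
            * (1 - B5Prop11Inverse.Pproj (fiberAt n M hn a ha q hq)))
          *ᵥ fun k' => (dft (fine n M) *ᵥ b) (pOf n M (k', q))) k := by
    simp only [Matrix.mulVec, dotProduct]
  have hP : (∑ k' : Fin d → Fin n, B5Prop11Inverse.Pproj (fiberAt n M hn a ha q hq) k k'
          * (dft (fine n M) *ᵥ b) (pOf n M (k', q)))
      = (B5Prop11Inverse.Pproj (fiberAt n M hn a ha q hq)
          *ᵥ fun k' => (dft (fine n M) *ᵥ b) (pOf n M (k', q))) k := by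
    simp only [Matrix.mulVec, dotProduct]
  rw [hR, ← Matrix.mulVec_mulVec, B5Prop11Inverse.lapSinv, Matrix.mulVec_diagonal,
    Matrix.sub_mulVec, Matrix.one_mulVec, Pi.sub_apply, ← hP, lambda0_eq_LapSinv,
    dft_LapSinv_apply, Matrix.sub_mulVec, Matrix.one_mulVec, Matrix.mulVec_sub, Pi.sub_apply,
    fiber_PcT n M hn a ha b k hq, lsym_pOf_fiber n M hn a ha hq k, one_div]

end

end Literature.MathematicalPhysics.QuantumFieldTheory.Balaban1983to89.B5Momentum133
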